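import Summits.ResolutionOfSingularities.ResolutionOfSingularities.Theorems.PlanarPortClasses
import Literature.AlgebraicGeometry.Resolution.PointBlowupFlagLostComponents
import HarnessLib

/-!
# PlanarSectionLift — decomp-res node «SectionLift» (lens-5 g25, critic row 172), tree file 1/2 of the node

Content VERBATIM from the decomp-res lens-5 g25 node `HOME/decomp-res-lens-5/g25/SectionLift.lean` rev 0 (pin
7f24a48a = `g25/parts/SectionLift-g25-7f24a48a.lean`,
1183 l; HOME = run/shared/lean/pub/decomp-res; node memo `g25/NODE.md` e0a4371c: node equation, tags, probes P1–P12
/ C1–C9, the certified LOW-LIVE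
ENTRANCE F₀→F₁→F₂→F₃ (q = 4, 𝔽₂) replayed by the census instrument (HOME/census/planar/entrance/T-entrance.md,
evidence #43 on 31770)).  ONLY the node's NEW
namespace `…Theorems.SectionLift` (node ll. 623–1183) is landed, as two tree files; the block the node CARRIED
verbatim (node ll. 52–621 = g24
`PlanarPort.lean` ll. 336–893) is DROPPED here because it has LANDED as `Theorems/PlanarPortFunctor` (p803190) ·
`PlanarPortFunctor2` (p803315) ·
`PlanarPortClasses` (p804042), which this file imports instead (every carried name resolves to the landed
declaration of the same name in
`…Theorems.PlanarPort`).  Critic: CRITIC-LEDGER row 172 (2026-08-31T03:01:27Z): **0 · 0 — BOOKED, CONVERSION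
RESERVED** (kernel lands as bookkeeping, like
rows 167/170; banked for good: the isolation DESCENT law, the `h = 0` law, conservation, the EXACT split, the exact
re-typing, the node equation,
`closes_sectionLift`).  Landing orders INBOX :746 (lens-5 rider) / :751 (critic, endorsed): two files ≤ 400 l named
so as not to collide with the two
unrelated `…SectionLift.lean` files already in Theorems/ (namespace stays the lens's `…Theorems.SectionLift`);
imports = landed `Theorems.PlanarPortClasses`
+ `Literature.AlgebraicGeometry.Resolution.PointBlowupFlagLostComponents` (for `expansion_axisFlag` / `isCaseN0`);
opens = node ll. 35–48 + the node's
`open …Theorems.PlanarPort`; `--kind proof --supports stmt-ResolutionOfSingularities-31770`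
(`MaxContactCut.DefectWalksDeep`); nothing closes 31770.
IN THE Theses CONE (through `PlanarPortClasses → … → PlanarCutStates → MaxContactCutExitLaw`), so — as for
«PlanarPort» (rev 49) — NO importable aside:
the column's ONE live planar aside stays the g24 leaf `PlanarPort.NoTerminalSectionPlanarJointTailsDeep`, recorded
on route item 28121's informal
(«= LowEmptyIsolated ∧ LowLiveTerminal exactly») and in HOME/TREE.md.

The lens header, verbatim:

> # SectionLift — isolation descent to the plane section, the `h = 0` terminal shapes unfolded, and the EXACT
> # low-layer split of the terminal residual of the planar port
> # (lens-5 «decomp-res», g25; node `…Theorems.SectionLift`, host route MaxContactCut, target 31770 BY NAME)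
>
> MODULE DOCSTRING: see `g25/NODE.md` (node equation, tags, probes, the ENTRANCE certificate).  This file carries
> VERBATIM the not-yet-landed part of the g24 node file `g24/PlanarPort.lean` (sha256 814caf7a…, lines 336–893:
> `§2` section states over `K̄`, `§3` [HP24] Props. 3–4 as named propositions, `§4` the port law, `§5` the classes and
> `closes_planarPort`) inside its own namespace `…Theorems.PlanarPort` — the landed part (`§1`, `map_deletePthPowers`)
> is IMPORTED from the tree file `Theorems/PlanarPortFunctor.lean` (writer-1 g10, p803190) — and then adds, in the new
> namespace `…Theorems.SectionLift`:
>
> * `§A` the plane section as a RING HOMOMORPHISM (`resHom`, `res_eq_resHom`) and its action on Hasse derivatives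
>   (`res_hasseDeriv_of_wall`, `res_hasseDeriv_eq_zero_of_lowEmpty`);
> * `§B` **ISOLATION DESCENT (PROVED):** if the wall layers `1 … q−1` of `F` are empty, the plane section of the top
>   ideal lies in the top ideal of the section, so `IsolatedTop q F → IsolatedTop q (res F)` and (base change)
>   `→ IsolatedTop q (secState i j k s).F` (`isolatedTop_res_of_lowEmpty`, `isolatedTop_secState_of_lowEmpty`);
> * `§C` the GIVEN-LETTER (`h = 0`) terminal shapes of [HP24] §3 UNFOLDED on polynomials (`expansion_of_h_zero`,
>   `exists_least_of_isMonomialCase_coe`, `exists_heavy_of_isSmallResidualCase_coe`) and on the threefold datum: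
>   an `h = 0` monomial section state has a monomial-led wall layer `0` (`isMonomialLed_layer_zero_of_monomialCase_h_zero`),
>   an `h = 0` small-residual one has a letter-heavy wall layer `0`, and a letter-heavy layer `0` over EMPTY low layers
>   makes `F` fat, hence NOT isolated (`not_isolatedTop_of_heavy_layer_zero_of_lowEmpty`);
> * `§D` the wall-layer datum `Λ = {a ∈ [1, q−1] : layer a ≠ ∅}` is CONSERVED along planar tails
>   (`layer_eq_empty_of_le`), the EXACT split of the g24 terminal leaf `NoTerminalSectionPlanarJointTailsDeep` into the
>   LOW-EMPTY and LOW-LIVE residual classes (`terminal_iff_lowEmpty_lowLive`), the low-empty class RE-TYPED with its two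
>   proved extra binders (isolated section at every `t ≥ N`; never an `h = 0` terminal flag), and `closes_sectionLift … :
>   MaxContactCut.DefectWalksDeep` BY NAME.

## This file

§A + §B of the node (ll. 629–889): §A the plane section as a RING HOMOMORPHISM (`resMap`, `resHom`, `res_eq_resHom`)
and its action on Hasse–Schmidt derivatives (`map_hasseDeriv_eq`, `res_hasseDeriv_of_wall`), the LOW-EMPTY predicate
`LowEmpty` (wall layers `1 … q−1` empty; `lowEmpty_iff_layer`, `res_hasseDeriv_eq_zero_of_lowEmpty`); §B **ISOLATION
DESCENT (PROVED)**: over empty low layers the plane section of the top ideal lies in the top ideal of the section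
(`map_topIdeal_le_of_lowEmpty`), so `IsolatedTop q F → IsolatedTop q (res F)` (`isolatedTop_res_of_lowEmpty`), base
change (`isolatedTop_map`) and **`isolatedTop_secState_of_lowEmpty`** (the isolated top point DESCENDS to the
section state over `K̄`).

[WRITER NOTE (decomp-res writer g11): file split only (tree files ≤ 400 lines); namespace, sections, section
variables and every declaration exactly as in
the lens (the lens's global dupNamespace-linter line is dropped — the library sets it); the node's `open
…Theorems.PlanarPort` (node l. 625, inside the
namespace) is replayed at the head of the namespace in each file.]

(Sources: HauserPerlega2024 (Publ. RIMS 60; §3 p. 775, Prop. 3 p. 791, Prop. 4 p. 793, §7 p. 788); Perlega2017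
(arXiv:2011.14443) §7.3; Hauser2010Kangaroo §F; BenitoVillamayor2012 §4; KawanoueMatsuki2016 §5; Moh1987;
CossartPiltant2008 §2.)
-/

open MvPolynomial Finset
open Literature.AlgebraicGeometry.Resolution
open Literature.AlgebraicGeometry.Resolution.Hauser2010
open Literature.AlgebraicGeometry.Resolution.HauserPerlega2024
open Literature.AlgebraicGeometry.Resolution.PointBlowup
open Literature.AlgebraicGeometry.Resolution.WeightedBlowup
open Summit.ResolutionOfSingularities.ResolutionOfSingularities.Theses
open Summit.ResolutionOfSingularities.ResolutionOfSingularities.Theorems.TightDefectClasses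
open Summit.ResolutionOfSingularities.ResolutionOfSingularities.Theorems.TightDefectStrongWalks
open Summit.ResolutionOfSingularities.ResolutionOfSingularities.Theorems.ItineraryCutClasses
open Summit.ResolutionOfSingularities.ResolutionOfSingularities.Theorems.ProximityCut
open Summit.ResolutionOfSingularities.ResolutionOfSingularities.Theorems.ExitLaw
open Summit.ResolutionOfSingularities.ResolutionOfSingularities.Theorems.PlanarCut
open Summit.ResolutionOfSingularities.ResolutionOfSingularities.Theorems.CoefficientCut

namespace Summit.ResolutionOfSingularities.ResolutionOfSingularities.Theorems.SectionLift

open Summit.ResolutionOfSingularities.ResolutionOfSingularities.Theorems.PlanarPort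

section Hom

variable {K : Type} [Field K]

/-! ## §A The plane section as a ring homomorphism; its action on Hasse–Schmidt derivatives -/

/-- The substitution of letters `u_i ↦ X₀, u_j ↦ X₁, u_k ↦ 0` (any third letter `↦ 0`).  DEFINITION (support). -/
noncomputable def resMap (K : Type) [Field K] (i j : Fin 3) (l : Fin 3) : MvPolynomial (Fin 2) K :=
  if l = i then X 0 else if l = j then X 1 else 0

/-- The plane section as a `K`-algebra homomorphism `K[u_i,u_j,u_k] → K[X₀,X₁]`.  DEFINITION (support). -/
noncomputable def resHom (K : Type) [Field K] (i j : Fin 3) : MvPolynomial (Fin 3) K →ₐ[K] MvPolynomial (Fin 2) K :=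
  aeval (resMap K i j)

variable {i j k : Fin 3}

/-- [folklore] -/
theorem resHom_X_i : resHom K i j (X i) = X 0 := by
  unfold resHom
  rw [aeval_X]
  exact if_pos rfl

/-- [folklore] -/
theorem resHom_X_j (hij : i ≠ j) : resHom K i j (X j) = X 1 := by
  unfold resHom
  rw [aeval_X]
  exact (if_neg hij.symm).trans (if_pos rfl)

/-- The section homomorphism on a monomial. [folklore] -/
theorem resHom_monomial (hij : i ≠ j) (hjk : j ≠ k) (hik : i ≠ k) (δ : Fin 3 →₀ ℕ) (a : K) :
    resHom K i j (monomial δ a) = C a * (X 0 ^ δ i * X 1 ^ δ j * (0 : MvPolynomial (Fin 2) K) ^ δ k) := by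
  have h1 : resMap K i j i = X 0 := if_pos rfl
  have h2 : resMap K i j j = X 1 := (if_neg hij.symm).trans (if_pos rfl)
  have h3 : resMap K i j k = 0 := (if_neg hik.symm).trans (if_neg hjk.symm)
  unfold resHom
  rw [aeval_monomial, algebraMap_eq, Finsupp.prod_fintype _ _ (fun l => pow_zero _), prod_three hij hjk hik]
  simp only [h1, h2, h3]

/-- **Coefficients of the section homomorphism (PROVED):** `coeff_c (resHom F) = coeff_{u_i^{c₀} u_j^{c₁}} F`. [folklore] -/
theorem coeff_resHom (hij : i ≠ j) (hjk : j ≠ k) (hik : i ≠ k) (F : MvPolynomial (Fin 3) K) (c : Fin 2 →₀ ℕ) :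
    coeff c (resHom K i j F) = coeff (liftExp i j k c) F := by
  classical
  induction F using MvPolynomial.induction_on' with
  | monomial δ a =>
    rw [resHom_monomial hij hjk hik, coeff_monomial]
    by_cases hδ : δ k = 0
    · rw [hδ, pow_zero, mul_one, X_pow_eq_monomial, X_pow_eq_monomial, monomial_mul, C_mul_monomial, coeff_monomial,
        mul_one, mul_one]
      have key : Finsupp.single (0 : Fin 2) (δ i) + Finsupp.single 1 (δ j) = c ↔ δ = liftExp i j k c := by
        constructor
        · intro h
          refine finsupp_ext_three hij hjk hik ?_ ?_ ?_
          · rw [liftExp_i hij hik, ← h]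
            simp
          · rw [liftExp_j hij hjk, ← h]
            simp
          · rw [liftExp_k hjk hik, hδ]
        · intro h
          subst h
          ext m
          fin_cases m
          · simp [liftExp_i hij hik]
          · simp [liftExp_j hij hjk]
      by_cases h : δ = liftExp i j k c
      · rw [if_pos h, if_pos (key.mpr h)]
      · rw [if_neg h, if_neg (fun h' => h (key.mp h'))]
    · rw [zero_pow hδ, mul_zero, mul_zero, coeff_zero, if_neg]
      intro h
      exact hδ (by rw [h, liftExp_k hjk hik])
  | add F G hF hG => rw [map_add, coeff_add, coeff_add, hF, hG]

/-- **The section IS the section homomorphism (PROVED):** `res F = resHom F`; in particular `res` is multiplicative and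
maps ideals to ideals. [folklore] -/
theorem res_eq_resHom (hij : i ≠ j) (hjk : j ≠ k) (hik : i ≠ k) (F : MvPolynomial (Fin 3) K) :
    res i j k F = resHom K i j F := by
  classical
  ext c
  rw [coeff_res hij hjk hik, coeff_resHom hij hjk hik]

/-- Coefficient formula for the tree's Hasse–Schmidt derivatives, any index type (linear extension of
`coeff_hasseDeriv_monomial`). (Sources: EGAIV4, Thm. 16.11.2.) [folklore] -/
theorem coeff_hasseDeriv_eq' {σ : Type*} [DecidableEq σ] (α β : σ →₀ ℕ) (F : MvPolynomial σ K) :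
    coeff β (hasseDeriv K α F) = ((∏ l ∈ α.support, ((α + β) l).choose (α l) : ℕ) : K) * coeff (α + β) F := by
  classical
  induction F using MvPolynomial.induction_on' with
  | monomial δ c =>
    rw [coeff_hasseDeriv_monomial, coeff_monomial]
    by_cases h : δ = α + β
    · subst h
      rw [if_pos rfl, if_pos rfl]
    · rw [if_neg h, if_neg h, mul_zero]
  | add p q hp hq => rw [map_add, coeff_add, coeff_add, hp, hq, mul_add]

/-- Base change commutes with the Hasse–Schmidt derivatives (re-proved; the Literature copy is private). [folklore] -/
theorem map_hasseDeriv_eq {σ : Type*} [DecidableEq σ] {L : Type*} [CommRing L] (f : K →+* L) (α : σ →₀ ℕ)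
    (G : MvPolynomial σ K) : MvPolynomial.map f (hasseDeriv K α G) = hasseDeriv L α (MvPolynomial.map f G) := by
  induction G using MvPolynomial.induction_on' with
  | monomial δ c =>
    rw [hasseDeriv_monomial, map_mul, map_natCast, map_monomial, map_monomial, hasseDeriv_monomial]
  | add p q hp hq => rw [map_add, map_add, hp, hq, map_add, map_add]

/-- The binomial product over the support is the product over all letters. [folklore] -/
theorem prod_choose_support_eq_univ {σ : Type*} [Fintype σ] (α β : σ →₀ ℕ) :
    (∏ l ∈ α.support, ((α + β) l).choose (α l)) = ∏ l, ((α + β) l).choose (α l) := by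
  refine Finset.prod_subset (Finset.subset_univ _) fun l _ hl => ?_
  rw [Finsupp.notMem_support_iff.mp hl, Nat.choose_zero_right]

/-- **The section of a Hasse derivative in a WALL direction (PROVED):** for `α_k = 0`,
`res (∂^{(α)} F) = ∂^{(α_i, α_j)} (res F)`. [new] [folklore] -/
theorem res_hasseDeriv_of_wall (hij : i ≠ j) (hjk : j ≠ k) (hik : i ≠ k) {α : Fin 3 →₀ ℕ} (hα : α k = 0)
    (F : MvPolynomial (Fin 3) K) :
    res i j k (hasseDeriv K α F) = hasseDeriv K (secExp i j α) (res i j k F) := by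
  classical
  have hlift : ∀ c : Fin 2 →₀ ℕ, liftExp i j k (secExp i j α + c) = α + liftExp i j k c := by
    intro c
    refine finsupp_ext_three hij hjk hik ?_ ?_ ?_
    · rw [liftExp_i hij hik, Finsupp.add_apply, Finsupp.add_apply, secExp_zero, liftExp_i hij hik]
    · rw [liftExp_j hij hjk, Finsupp.add_apply, Finsupp.add_apply, secExp_one, liftExp_j hij hjk]
    · rw [liftExp_k hjk hik, Finsupp.add_apply, hα, liftExp_k hjk hik]
  have hprod : ∀ c : Fin 2 →₀ ℕ, (∏ l ∈ α.support, ((α + liftExp i j k c) l).choose (α l)) =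
      ∏ m ∈ (secExp i j α).support, ((secExp i j α + c) m).choose (secExp i j α m) := by
    intro c
    rw [prod_choose_support_eq_univ, prod_choose_support_eq_univ, prod_three hij hjk hik,
      prod_two (show (0 : Fin 2) ≠ 1 by decide)]
    simp only [Finsupp.add_apply, liftExp_i hij hik, liftExp_j hij hjk, liftExp_k hjk hik, secExp_zero, secExp_one, hα,
      Nat.choose_zero_right, mul_one]
  ext c
  rw [coeff_res hij hjk hik, coeff_hasseDeriv_eq', coeff_hasseDeriv_eq', coeff_res hij hjk hik, hlift, hprod]

/-- LOW WALL LAYERS EMPTY: every exponent of `F` has `d_k = 0` or `d_k ≥ q` (the layers `1 … q−1` of the wall letter are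
empty).  DEFINITION (support). -/
def LowEmpty (q : ℕ) (k : Fin 3) (F : MvPolynomial (Fin 3) K) : Prop :=
  ∀ d ∈ F.support, d k = 0 ∨ q ≤ d k

/-- `LowEmpty` in the tree's layer letters. [folklore] -/
theorem lowEmpty_iff_layer {q : ℕ} {F : MvPolynomial (Fin 3) K} :
    LowEmpty q k F ↔ ∀ a, 1 ≤ a → a < q → layer k a F = ∅ := by
  classical
  constructor
  · intro h a ha1 haq
    refine Finset.eq_empty_iff_forall_notMem.mpr fun d hd => ?_
    rw [mem_layer] at hd
    rcases h d (MvPolynomial.mem_support_iff.mpr hd.1) with h0 | hq <;> omega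
  · intro h d hd
    by_contra hne
    push Not at hne
    have hmem : d ∈ layer k (d k) F := mem_layer.mpr ⟨MvPolynomial.mem_support_iff.mp hd, rfl⟩
    rw [h (d k) (by omega) (by omega)] at hmem
    exact absurd hmem (Finset.notMem_empty d)

/-- **The section of a Hasse derivative in a LOW direction VANISHES over empty low layers (PROVED):** for
`1 ≤ α_k < q`, `res (∂^{(α)} F) = 0`. [new] [folklore] -/
theorem res_hasseDeriv_eq_zero_of_lowEmpty (hij : i ≠ j) (hjk : j ≠ k) (hik : i ≠ k) {q : ℕ}
    {F : MvPolynomial (Fin 3) K} (hF : LowEmpty q k F) {α : Fin 3 →₀ ℕ} (h1 : 1 ≤ α k) (h2 : α k < q) :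
    res i j k (hasseDeriv K α F) = 0 := by
  classical
  ext c
  rw [coeff_res hij hjk hik, coeff_hasseDeriv_eq', coeff_zero]
  have : coeff (α + liftExp i j k c) F = 0 := by
    by_contra hne
    rcases hF _ (MvPolynomial.mem_support_iff.mpr hne) with h | h
    · rw [Finsupp.add_apply, liftExp_k hjk hik, add_zero] at h
      omega
    · rw [Finsupp.add_apply, liftExp_k hjk hik, add_zero] at h
      omega
  rw [this, mul_zero]

end Hom

section Descent

variable {K : Type} [Field K]
variable {i j k : Fin 3}

/-! ## §B ISOLATION DESCENT: over empty low layers the isolated top point descends to the plane section -/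

/-- **The section maps the top ideal into the top ideal of the section (PROVED, low layers empty):**
`res(J_F) ⊆ J_{res F}` — wall directions go to the derivatives of the section (`res_hasseDeriv_of_wall`), low directions
to `0` (`res_hasseDeriv_eq_zero_of_lowEmpty`), and directions with `α_k ≥ q` do not occur in `J_F`. [new] [folklore] -/
theorem map_topIdeal_le_of_lowEmpty (hij : i ≠ j) (hjk : j ≠ k) (hik : i ≠ k) {q : ℕ} {F : MvPolynomial (Fin 3) K}
    (hF : LowEmpty q k F) : Ideal.map (resHom K i j) (topIdeal q F) ≤ topIdeal q (res i j k F) := by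
  classical
  unfold topIdeal
  rw [Ideal.map_span]
  refine Ideal.span_le.mpr ?_
  rintro _ ⟨_, ⟨α, ⟨hα0, hαq⟩, rfl⟩, rfl⟩
  rw [SetLike.mem_coe]
  change resHom K i j (hasseDeriv K α F) ∈ _
  rw [← res_eq_resHom hij hjk hik]
  by_cases hαk : α k = 0
  · rw [res_hasseDeriv_of_wall hij hjk hik hαk]
    by_cases hsec : secExp i j α = 0
    · exfalso
      apply hα0
      rw [← liftExp_secExp hij hjk hik hαk, hsec]
      refine finsupp_ext_three hij hjk hik ?_ ?_ ?_
      · rw [liftExp_i hij hik, Finsupp.zero_apply, Finsupp.zero_apply]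
      · rw [liftExp_j hij hjk, Finsupp.zero_apply, Finsupp.zero_apply]
      · rw [liftExp_k hjk hik, Finsupp.zero_apply]
    · exact Ideal.subset_span ⟨secExp i j α, ⟨hsec, by rw [degree_secExp hij hjk hik hαk]; exact hαq⟩, rfl⟩
  · by_cases hq : α k < q
    · rw [res_hasseDeriv_eq_zero_of_lowEmpty hij hjk hik hF (Nat.one_le_iff_ne_zero.mpr hαk) hq]
      exact Ideal.zero_mem _
    · exfalso
      have := degree_three hij hjk hik α
      omega

/-- **ISOLATION DESCENT (PROVED):** if the low wall layers of `F` are empty and the origin is an isolated top point of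
`Z^q + F`, then the origin of the PLANE is an isolated top point of the section `Z^q + (res F)(X₀, X₁)`. [new] [folklore] -/
theorem isolatedTop_res_of_lowEmpty [DecidableEq K] (hij : i ≠ j) (hjk : j ≠ k) (hik : i ≠ k) {q : ℕ}
    {F : MvPolynomial (Fin 3) K}
    (hF : LowEmpty q k F) (hiso : IsolatedTop q F) : IsolatedTop q (res i j k F) := by
  classical
  obtain ⟨N, g, hg0, hg⟩ := hiso
  refine ⟨N, res i j k g, ?_, fun m => ?_⟩
  · have h0 : liftExp i j k (0 : Fin 2 →₀ ℕ) = 0 :=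
      finsupp_ext_three hij hjk hik (by rw [liftExp_i hij hik, Finsupp.zero_apply, Finsupp.zero_apply])
        (by rw [liftExp_j hij hjk, Finsupp.zero_apply, Finsupp.zero_apply]) (by rw [liftExp_k hjk hik, Finsupp.zero_apply])
    have : coeff 0 (res i j k g) = coeff 0 g := by rw [coeff_res hij hjk hik, h0]
    change coeff 0 (res i j k g) ≠ 0
    rw [this]
    exact hg0
  · have hm : ∃ l : Fin 3, resHom K i j (X l) = X m := by
      fin_cases m
      · exact ⟨i, resHom_X_i⟩
      · exact ⟨j, resHom_X_j hij⟩
    obtain ⟨l, hl⟩ := hm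
    have h1 := Ideal.mem_map_of_mem (resHom K i j) (hg l)
    rw [map_mul, map_pow, hl, ← res_eq_resHom hij hjk hik] at h1
    exact map_topIdeal_le_of_lowEmpty hij hjk hik hF h1

/-- The top ideal commutes with base change: `map f (J_P) ⊆ J_{map f P}`. [folklore] -/
theorem map_topIdeal_le_map {σ : Type} [DecidableEq σ] {L : Type} [Field L] (f : K →+* L) (q : ℕ)
    (P : MvPolynomial σ K) : Ideal.map (MvPolynomial.map f) (topIdeal q P) ≤ topIdeal q (MvPolynomial.map f P) := by
  classical
  unfold topIdeal
  rw [Ideal.map_span]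
  refine Ideal.span_le.mpr ?_
  rintro _ ⟨_, ⟨α, hα, rfl⟩, rfl⟩
  exact Ideal.subset_span ⟨α, hα, (map_hasseDeriv_eq f α P).symm⟩

/-- An isolated top point stays isolated under an (injective) base change of the ground field. [folklore] -/
theorem isolatedTop_map {σ : Type} [DecidableEq σ] {L : Type} [Field L] [DecidableEq L] (f : K →+* L) {q : ℕ}
    {P : MvPolynomial σ K} (h : IsolatedTop q P) : IsolatedTop q (MvPolynomial.map f P) := by
  classical
  obtain ⟨N, g, hg0, hg⟩ := h
  refine ⟨N, MvPolynomial.map f g, ?_, fun l => ?_⟩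
  · rw [constantCoeff_map]
    exact (map_ne_zero_iff f f.injective).mpr hg0
  · have h1 := Ideal.mem_map_of_mem (MvPolynomial.map f) (hg l)
    rw [map_mul, map_pow, map_X] at h1
    exact map_topIdeal_le_map f q P h1

/-- **ISOLATION DESCENT TO THE SECTION STATE (PROVED):** over empty low wall layers, an isolated top point of the
threefold state gives an isolated top point of the section state `secState i j k s` (plane section over `K̄`). [new]
[folklore] -/
theorem isolatedTop_secState_of_lowEmpty [DecidableEq K] (hij : i ≠ j) (hjk : j ≠ k) (hik : i ≠ k) {q : ℕ}
    {s : State (Fin 3) K} (hF : LowEmpty q k s.F) (hiso : IsolatedTop q s.F) :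
    IsolatedTop q (secState i j k s).F := by
  classical
  rw [secState_F]
  exact isolatedTop_map (ι K) (isolatedTop_res_of_lowEmpty hij hjk hik hF hiso)

end Descent

end Summit.ResolutionOfSingularities.ResolutionOfSingularities.Theorems.SectionLift
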